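import Literature.NumberTheory.EllipticCurves.Jetchev2008.CoreVertices
import HarnessLib

/-!
# Jetchev 2008, Prop. 5.3 (printed) in the shape consumed by the cell's road-K kernel

The sibling `Jetchev2008/CoreVertices.lean` vendors printed Prop. 5.3 of D. Jetchev, Compos. Math.
**144** (2008) 811–826 (= arXiv:math/0703431 Prop. 6.4; existence of core vertices) as the named
fact `Jetchev2008.prop53_exists_coreVertex_of_depth_add_le_levelIndex`, in the datum-by-datum
currency of the printed text (`p^s ∥ P_c` for a Kolyvagin–Heegner datum `d` of conductor `c`).
The cell `bsd-jet`'s kernel line (sheet `HOME/sheets/PV2-J6-KERNEL.ADDENDUM-1.md` §1; theorem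
`Summit.BirchSwinnertonDyer.Rank1Residual.JET.derivedPoint_divisible_of_prop52_of_section6`,
`Summits/…/Theorems/Rank1ResidualJetSection6Bridge.lean`) consumes Prop. 5.3 in an `ℕ∞`-valued
FUNCTION currency: conductors `c` in the subtype `Λ` of square-free products of Kolyvagin primes,
a depth function `mdiv : Λ → ℕ∞` characterised by `(u : ℕ∞) ≤ mdiv c ↔ ∀ d, p^u ∣ P_c^{(d)}`
(the printed `m'(c)`, minimised over the data), `m c = mdiv c` if `mdiv c < M(c)` and `⊤` otherwise
(the printed `m(c)`, McCallum's convention at the boundary), and the clause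
`h64 : ∀ k c, m c + k ≤ M(c) → ∃ c', Core k c' ∧ k + m c ≤ M(c') ∧ m c' ≤ m c` for a predicate
`Core`. This file PROVES that clause from the named fact with `Core k c := IsGlobalCoreVertex … k c`
(theorems only; no new fact, no definition — D-0026), for levels `k ≥ 1` and finite `m c` (the
printed hypothesis *"`m(c) + m ≤ M(c)`"* is about a finite `m(c)`; in the `ℕ∞` encoding `m c = ⊤`
can meet the premise only at `c = 1`, where print has `m(1) = m₀ < ∞`), under ONE extra input that
print uses silently: a TORSION derived point is `p^u`-divisible for every `u` (print's convention
*"If `P_c` is torsion then `m'(c) = ∞`"*, p. 818 [url p0008 L38–L39]; true because `E(K[c])` has no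
`p`-torsion under Hypothesis (∗) — [Gro91, Lemma 4.3] —, so torsion points have order prime to
`p`), taken as the hypothesis `htors` to be discharged by the instantiation layer.
HONEST FRAMING (programme §HONESTY): typed ≠ proved ≠ endorsed; this file moves no class; it turns
a named printed proposition into the exact hypothesis shape of a kernel theorem, nothing more.

## References

* [Jetchev2008] D. Jetchev, Compos. Math. 144 (2008) 811–826: Prop. 5.3 (p. 823) = arXiv Prop. 6.4;
  §4.1.4 (p. 818) `m'(c)`, `m(c)`; Proof of Thm. 1.1 (p. 824) — printed text
  `paper:url-36a580584b69`, arXiv text `paper:arxiv-math_0703431`.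
* [GrossLMS1991] B. H. Gross, LMS LN 153 (1991), Lemma 4.3 (no `p`-torsion over `K[n]`).
* [McCallumLMS1991] W. G. McCallum, same volume, §5 (`ord_p(P_n)`, `n ∈ S_r(ord_p P_n + 1)`).
-/

noncomputable section

open scoped Classical

open WeierstrassCurve NumberField IsDedekindDomain Literature.NumberTheory.EllipticCurves
  Literature.NumberTheory.EllipticCurves.ModularForms Literature.NumberTheory.GaloisRepresentations

namespace Literature.NumberTheory.EllipticCurves.Jetchev2008

/-- **Printed Prop. 5.3 ⟹ the kernel's clause `h64`** (Jetchev 2008, p. 823: *"Let `c ∈ Λ` satisfy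
`m(c) + m ≤ M(c)`. There exists a core vertex `c' ∈ Λ_{m+m(c)}`, such that `m(c') ≤ m(c)`"*), with
`Core k c := IsGlobalCoreVertex W K ι τ p k c`, in the currency of
`JET.derivedPoint_divisible_of_prop52_of_section6` (module docstring): for `k ≥ 1`, a conductor
`c ∈ Λ` with `m c` finite and `m c + k ≤ M(c)`, there is `c' ∈ Λ` with `IsGlobalCoreVertex … k c'`,
`k + m c ≤ M(c')` and `m c' ≤ m c`. PROOF: `m c = mdiv c = s < M(c)`; the characterisation of `mdiv`
gives `p^s ∣ P_c^{(d)}` for all data and a datum `d` with `p^{s+1} ∤ P_c^{(d)}` (non-torsion by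
`htors`); the fact yields `c' ∈ Λ_{k+s}`, a core vertex for `k`, and a datum `d'` with
`p^{s+1} ∤ P_{c'}^{(d')}`, whence `mdiv c' ≤ s < k + s ≤ M(c')` and `m c' = mdiv c' ≤ s = m c`.
[cite: Jetchev2008, Prop. 5.3 (p. 823) = arXiv Prop. 6.4, with §4.1.4 (p. 818)]
[cite: GrossLMS1991, Lemma 4.3 (the input behind `htors`)] -/
theorem exists_isGlobalCoreVertex_of_prop53
    (h53 : prop53_exists_coreVertex_of_depth_add_le_levelIndex)
    (W : WeierstrassCurve ℚ) [W.IsElliptic] [W.IsGloballyMinimal] [NeZero (W.conductorNorm ℤ)]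
    (hcm : ¬ W.HasCM) (K : Type) [Field K] [NumberField K] (hK : IsImaginaryQuadratic K)
    (hD3 : NumberField.discr K ≠ -3) (hD4 : NumberField.discr K ≠ -4)
    (hH : SatisfiesHeegnerHypothesis (W.conductorNorm ℤ) K)
    (τ : K ≃ₐ[ℚ] K) (hτ : τ ≠ 1)
    (p : ℕ) [Fact p.Prime] (hp2 : p ≠ 2) (hpN : ¬ p ∣ W.conductorNorm ℤ)
    (hρ : W.HasSurjectiveModNGaloisRep p)
    (Dt : ModularParametrizationData W (W.conductorNorm ℤ)) (β : ℤ) (ι : K →+* ℂ)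
    [∀ j : ℕ, NumberField (ringClassField K ι j)]
    (d₁ : KolyvaginHeegnerData Dt β ι 1) (hy : ¬ IsOfFinAddOrder d₁.derivedPoint)
    (htors : ∀ (c : ℕ) (d : KolyvaginHeegnerData Dt β ι c), IsOfFinAddOrder d.derivedPoint →
      ∀ u : ℕ, ∃ Q : (W.baseChange (ringClassField K ι c)).toAffine.Point,
        ((p ^ u : ℕ) : ℤ) • Q = d.derivedPoint)
    (mdiv m : {c : ℕ // Squarefree c ∧ ∀ ℓ ∈ c.primeFactors,
        Zhang2014.IsKolyvaginPrime (W.conductorNorm ℤ) W K p ℓ} → ℕ∞)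
    (hmdiv : ∀ c (u : ℕ), (u : ℕ∞) ≤ mdiv c ↔ ∀ d : KolyvaginHeegnerData Dt β ι c.1,
      ∃ Q : (W.baseChange (ringClassField K ι c.1)).toAffine.Point,
        ((p ^ u : ℕ) : ℤ) • Q = d.derivedPoint)
    (hm : ∀ c, m c = if mdiv c < Zhang2014.levelIndex W p c.1 then mdiv c else ⊤)
    (k : ℕ) (hk : 1 ≤ k)
    (c : {c : ℕ // Squarefree c ∧ ∀ ℓ ∈ c.primeFactors,
        Zhang2014.IsKolyvaginPrime (W.conductorNorm ℤ) W K p ℓ})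
    (hfin : m c ≠ ⊤) (hck : m c + k ≤ Zhang2014.levelIndex W p c.1) :
    ∃ c' : {c : ℕ // Squarefree c ∧ ∀ ℓ ∈ c.primeFactors,
        Zhang2014.IsKolyvaginPrime (W.conductorNorm ℤ) W K p ℓ},
      IsGlobalCoreVertex W K ι τ p k c'.1 ∧
        (k : ℕ∞) + m c ≤ Zhang2014.levelIndex W p c'.1 ∧ m c' ≤ m c := by
  -- Step 1: `m c = mdiv c = s` is finite and `< M(c)`.
  have hlt : mdiv c < Zhang2014.levelIndex W p c.1 := by
    by_contra hnot
    exact hfin (by rw [hm c, if_neg hnot])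
  have hmc : m c = mdiv c := by rw [hm c, if_pos hlt]
  have hne : mdiv c ≠ ⊤ := fun htop => hfin (by rw [hmc, htop])
  obtain ⟨s, hs⟩ : ∃ s : ℕ, mdiv c = s := ⟨(mdiv c).toNat, (ENat.coe_toNat hne).symm⟩
  -- Step 2: depth exactly `s` on the data of conductor `c`.
  have hdiv : ∀ d : KolyvaginHeegnerData Dt β ι c.1,
      ∃ Q : (W.baseChange (ringClassField K ι c.1)).toAffine.Point,
        ((p ^ s : ℕ) : ℤ) • Q = d.derivedPoint :=
    (hmdiv c s).mp (by rw [hs])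
  have hndiv : ¬ ∀ d : KolyvaginHeegnerData Dt β ι c.1,
      ∃ Q : (W.baseChange (ringClassField K ι c.1)).toAffine.Point,
        ((p ^ (s + 1) : ℕ) : ℤ) • Q = d.derivedPoint := by
    intro h
    have h' := (hmdiv c (s + 1)).mpr h
    rw [hs, Nat.cast_le] at h'
    omega
  obtain ⟨d, hd⟩ := not_forall.mp hndiv
  have hnt : ¬ IsOfFinAddOrder d.derivedPoint := fun hfo => hd (htors c.1 d hfo (s + 1))
  -- Step 3: `s + k ≤ M(c)`.
  have hsk : ((s + k : ℕ) : ℕ∞) ≤ Zhang2014.levelIndex W p c.1 := by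
    have h' := hck
    rw [hmc, hs] at h'
    exact_mod_cast h'
  -- Step 4: the printed proposition.
  obtain ⟨c', d', hsq, hℓ, hcore, -, hndiv'⟩ :=
    h53 W hcm K hK hD3 hD4 hH τ hτ p hp2 hpN hρ Dt β ι d₁ hy k hk c.1 d c.2.1 c.2.2 s hnt
      (hdiv d) hd hsk
  let C' : {c : ℕ // Squarefree c ∧ ∀ ℓ ∈ c.primeFactors,
      Zhang2014.IsKolyvaginPrime (W.conductorNorm ℤ) W K p ℓ} :=
    ⟨c', hsq, fun ℓ hℓ' => (hℓ ℓ hℓ').1⟩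
  have h1 : ((k + s : ℕ) : ℕ∞) ≤ Zhang2014.levelIndex W p c' :=
    natCast_add_le_levelIndex_of_forall (fun ℓ hℓ' => (hℓ ℓ hℓ').2)
  refine ⟨C', hcore, ?_, ?_⟩
  · -- `k + m c = k + s ≤ M(c')`
    rw [hmc, hs]
    exact_mod_cast h1
  · -- `m c' ≤ s = m c`
    have hmdiv' : mdiv C' ≤ (s : ℕ∞) := by
      by_contra hgt
      rw [not_le] at hgt
      have hle : ((s + 1 : ℕ) : ℕ∞) ≤ mdiv C' := by
        rw [Nat.cast_succ]
        exact Order.add_one_le_of_lt hgt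
      exact hndiv' ((hmdiv C' (s + 1)).mp hle d')
    have hsks : (s : ℕ∞) < ((k + s : ℕ) : ℕ∞) := by
      rw [Nat.cast_lt]
      omega
    have hlt' : mdiv C' < Zhang2014.levelIndex W p c' :=
      lt_of_le_of_lt hmdiv' (lt_of_lt_of_le hsks h1)
    have hmC' : m C' = mdiv C' := by rw [hm C', if_pos hlt']
    rw [hmC', hmc, hs]
    exact hmdiv'

end Literature.NumberTheory.EllipticCurves.Jetchev2008

end
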